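import Summits.BirchSwinnertonDyer.BirchSwinnertonDyer.Theses.LeadingTerm
import Summits.BirchSwinnertonDyer.BirchSwinnertonDyer.Theorems.TamePinch.Negative.CMQuarticImage

/-!
# `LeadingTerm.TamePinchR` (crux stmt-BirchSwinnertonDyer-17007): the hypothesis `¬ W.HasCM` is
# load-bearing (negative-side support; this file does NOT refute the crux)

`TamePinchR` (rev-6 repair of the refuted `TamePinch`) reads
`∀ W elliptic globally-minimal, ¬ W.HasCM → ∃ admissible p ≥ 5, certificate`. Dropping the repair
hypothesis `¬ W.HasCM` gives a FALSE statement — the body of the old `TamePinch` — and the witness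
is the one that killed `TamePinch`: the CM curve `y² = x³ − x` (Cremona 32a2, `[0,0,0,−1,0]`,
`j = 1728`, globally minimal) has no odd prime `p` with `ρ̄_{W,p}` onto `GL₂(𝔽_p)`
(`Theorems.tamePinch_not_hasSurjectiveModNGaloisRep_quartic`, Serre 1972 §4.5, Zywina 2015
Prop. 1.14), so the admissible-prime clause already fails. Hence ANY proof of `TamePinchR` must use
`¬ W.HasCM` (it is consumed by Serre's open-image theorem: cofinitely many surjective `p` for a
non-CM curve). Standing-disprover seat refuter-cdisprove-stmt-BirchSwinnertonDyer-17007-0, cycle 1;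
work file `Cruxes/TamePinchR/Disproof.lean` §1.
-/

noncomputable section

-- D-0017: single-problem summit, so `Summit.BirchSwinnertonDyer.BirchSwinnertonDyer.…` repeats a
-- namespace BY DESIGN.
set_option linter.dupNamespace false

namespace Summit.BirchSwinnertonDyer.BirchSwinnertonDyer.Theorems.TamePinchR.Negative

open scoped MatrixGroups ModularForm
open CongruenceSubgroup Literature.NumberTheory.EllipticCurves
  Literature.NumberTheory.EllipticCurves.ModularForms
open WeierstrassCurve

/-- **`¬ W.HasCM` is load-bearing in `TamePinchR`.** The crux with that hypothesis deleted (i.e.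
the body of the refuted parent `TamePinch`, stmt-BirchSwinnertonDyer-15532) is false: at the CM
curve `W = [0,0,0,−1,0]` (32a2) no prime `p ≥ 5` has surjective mod-`p` image, so no admissible
prime exists. Any proof of `TamePinchR` must use `¬ W.HasCM`. [folklore] -/
theorem tamePinchR_false_without_nonCM :
    ¬ ∀ (W : WeierstrassCurve ℚ) [W.IsElliptic] [W.IsGloballyMinimal],
      ∃ (p : ℕ) (_ : Fact p.Prime), 5 ≤ p ∧ IsOrdinaryAt W p ∧
        W.HasSurjectiveModNGaloisRep (p : ℤ) ∧
        ∃ (N : ℕ) (_ : NeZero N) (f : CuspForm (Gamma0 N) 2), IsNewformOf W f ∧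
          ∃ (n : ℕ) (_ : NeZero n), Squarefree n ∧ n.primeFactors.card = W.mordellWeilRank ∧
            (∀ ℓ ∈ n.primeFactors, ¬ ℓ ∣ N * p ∧ (ℓ : ZMod p) = 1 ∧
              (W.frobeniusTrace ℓ : ZMod p) = 2) ∧
            ∃ ψ : (ℓ : ℕ) → (ZMod ℓ)ˣ →* Multiplicative (ZMod p),
              (∀ ℓ ∈ n.primeFactors, Function.Surjective (ψ ℓ)) ∧
              (∑ a : (ZMod n)ˣ, (ratPlusSymbol f (((a : ZMod n).val : ℚ) / n) : ZMod p) *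
                ∏ ℓ ∈ n.primeFactors.attach,
                  Multiplicative.toAdd
                    (ψ ℓ.1 (ZMod.unitsMap (Nat.dvd_of_mem_primeFactors ℓ.2) a))) ≠ 0 := by
  intro h
  haveI : (⟨0, 0, 0, -1, 0⟩ : WeierstrassCurve ℚ).IsElliptic := isElliptic_quartic (by norm_num)
  haveI : (⟨0, 0, 0, -1, 0⟩ : WeierstrassCurve ℚ).IsGloballyMinimal :=
    Theorems.tamePinch_isGloballyMinimal_thirtyTwoA2
  obtain ⟨p, hp, h5, -, hsurj, -⟩ := h ⟨0, 0, 0, -1, 0⟩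
  exact Theorems.tamePinch_not_hasSurjectiveModNGaloisRep_quartic (D := -1) (by norm_num) p
    (by omega) hsurj

end Summit.BirchSwinnertonDyer.BirchSwinnertonDyer.Theorems.TamePinchR.Negative

end
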